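import Summits.QuantumFields.GaugeBoot.ZdLoopEquationStates
import Summits.QuantumFields.GaugeBoot.LoopEquationSU2Loops
import HarnessLib

/-!
# The `SU(2)` loop equation of a Haar-shift state on `ℤ^d` in SINGLE-LOOP normal form (gauge-boot, Class-B rows 2/3)

HONEST FRAMING (cell `pub-gaugeboot`, page 1 of every file): the venture produces certified bounds
on lattice expectations at stated coupling, gauge group, dimension and torus size; NOT a mass gap,
NOT a continuum limit, NOT a string tension; NOT Yang–Mills-summit-bearing (barriers
`FixedCouplingUltralocality`, `PerturbativeInvisibility`).

`LoopEquationSU2Loops.lean` turns the torus loop equation of a closed word into the generators' `SU(2)`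
normal form (single loops only, via `tr A · tr B = tr(AB) + tr(AB⁻¹)`), the identity behind the
rows-as-data engine `MMRowSU2.lean`. This file is the same reduction for an arbitrary finite measure
`μ` on `LGConfig d SU(2)` satisfying the one-link Haar-shift identity (`ZdLoopEquationStates.lean`), in
the `ℤ^d` loop variables `E_v = ∫ W_x(v) dμ = ∫ wordLoopZd (suRep 2) x v dμ` of `ClassBWords.lean`:

* `IsHaarShiftState.loopEquationZd_schema_suN` — the `SU(N)` schema of `ZdLoopEquation.lean` with the
  representation written as `fundamentalRep (Fin N)`;
* `trace_split_su_two_zd`, `plaqTerm_su_two_zd`, `integral_trace_su_two_zd`, `integral_split_su_two_zd`,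
  `integral_plaqTerm_su_two_zd` — the pointwise / integrated `SU(2)` reductions on `ℤ^d`;
* **`IsHaarShiftState.loopEquation_su_two_loops`** — for `w` closed at `x` (no smallness hypothesis:
  every word is small on `ℤ^d`) and the link `(x, a)`:
  `Σ_{k ∈ fwdOccZ} (E_w + 2 E_{w[0,k)·(w[k,n))⁻¹}) − Σ_{k ∈ bwdOccZ} (E_w + 2 E_{w[0,k]·(w(k,n))⁻¹})`
  `+ β·Σ_{ν ≠ a} Σ_ε (E_{w·P̃(a,ν,ε)} − E_{w·P̃(a,ν,ε)⁻¹}) = 0` (`β` the tree coupling of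
  `IsHaarShiftState`), and **`ClassBState.loopEquation_su_two_loops`**.

Everything is `[folklore]` (Makeenko–Migdal rows in `SU(2)` normal form: Kazakov–Zheng arXiv:2203.11360
§2; Guo–Li–Yang–Zhu arXiv:2502.14421 §4).
-/

noncomputable section

open MeasureTheory
open scoped Matrix
open Literature.Probability.LatticeModels (Site)
open Literature.MathematicalPhysics.QuantumLattice (LGConfig ZdEdge fundamentalRep fundamentalLatticeRep
  continuous_fundamentalRep)

namespace Summit.QuantumFields.GaugeBoot

variable {d : ℕ}

/-! ### The `SU(N)` schema, representation written out -/

section Schema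

variable {N : ℕ}

/-- The `SU(N)` loop-equation schema of a Haar-shift state on `ℤ^d` (`ZdLoopEquation.loopEquationZd_schema`
at `r = fundamentalLatticeRep N`, `s = 1`), periodic notation. [folklore] -/
theorem IsHaarShiftState.loopEquationZd_schema_suN {β : ℝ} {μ : Measure (LGConfig d (SU N))}
    [IsFiniteMeasure μ] (hμ : IsHaarShiftState (fundamentalRep (Fin N)) β μ) (x : Site d) (a : Fin d)
    (w : Word d) (hw : TiltedRP.Word.endpoint (TiltedRP.zdUnit d) x w = x) :
    (∑ k ∈ (Finset.range w.length).filter (w.fwdOccZ a),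
        ∫ U, ((fundamentalRep (Fin N) (TiltedRP.wordHolonomy (TiltedRP.zdUnit d) U x (w.take k))).trace *
            (fundamentalRep (Fin N) (TiltedRP.wordHolonomy (TiltedRP.zdUnit d) U
              (TiltedRP.Word.siteAt (TiltedRP.zdUnit d) x w k) (w.drop k))).trace -
          (1 / N) * (fundamentalRep (Fin N) (TiltedRP.wordHolonomy (TiltedRP.zdUnit d) U x w)).trace) ∂μ) -
      (∑ k ∈ (Finset.range w.length).filter (w.bwdOccZ a),
        ∫ U, ((fundamentalRep (Fin N) (TiltedRP.wordHolonomy (TiltedRP.zdUnit d) U x (w.take (k + 1)))).trace *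
            (fundamentalRep (Fin N) (TiltedRP.wordHolonomy (TiltedRP.zdUnit d) U
              (TiltedRP.Word.siteAt (TiltedRP.zdUnit d) x w (k + 1)) (w.drop (k + 1)))).trace -
          (1 / N) * (fundamentalRep (Fin N) (TiltedRP.wordHolonomy (TiltedRP.zdUnit d) U x w)).trace) ∂μ) +
      (β / 2 : ℂ) * ∑ ν ∈ Finset.univ.erase a, ∑ ε : Bool,
        ∫ U, TiltedRP.plaqTerm (fundamentalRep (Fin N)) (TiltedRP.zdUnit d) 1 x a U w ν ε ∂μ = 0 :=
  TiltedRP.loopEquationZd_schema μ (fundamentalLatticeRep N) β x a 1 w hw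
    fun i j => TiltedRP.sdPairZd_specialUnitaryGroup N hμ x a x w _ (trace_unitDir_one i j)

end Schema

/-! ### Pointwise `SU(2)` reductions on `ℤ^d` -/

section Pointwise

/-- If `w` is closed at `x` and so is its prefix `w[0,k)`, then so is the suffix read from `x`. [folklore] -/
theorem Word.endpointZd_drop_of_take (x : Site d) (w : Word d) (k : ℕ) (hw : Word.endpointZd x w = x)
    (hk : Word.endpointZd x (w.take k) = x) : Word.endpointZd x (w.drop k) = x := by
  have h := Word.endpointZd_append x (w.take k) (w.drop k)
  rw [List.take_append_drop, hw, hk] at h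
  exact h.symm

/-- **Split product ↦ single loops, pointwise on `ℤ^d`** (`SU(2)`): for `w` closed at `x` with `w[0,k)`
closed at `x`, `tr U_{w[0,k)} · tr U_{w[k,n)} = tr U_w + tr U_{w[0,k)·(w[k,n))⁻¹}`. [folklore] -/
theorem trace_split_su_two_zd (x : Site d) (w : Word d) (k : ℕ) (hw : Word.endpointZd x w = x)
    (hk : Word.endpointZd x (w.take k) = x) (U : LGConfig d (SU 2)) :
    (fundamentalRep (Fin 2) (wordHolonomyZd U x (w.take k))).trace *
        (fundamentalRep (Fin 2) (wordHolonomyZd U x (w.drop k))).trace =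
      (fundamentalRep (Fin 2) (wordHolonomyZd U x w)).trace +
        (fundamentalRep (Fin 2) (wordHolonomyZd U x (w.take k ++ Word.reverse (w.drop k)))).trace := by
  have hdrop : Word.endpointZd x (w.drop k) = x := Word.endpointZd_drop_of_take x w k hw hk
  have e1 : wordHolonomyZd U x w = wordHolonomyZd U x (w.take k) * wordHolonomyZd U x (w.drop k) := by
    conv_lhs => rw [← List.take_append_drop k w]
    rw [wordHolonomyZd_append, hk]
  have e2 : wordHolonomyZd U x (w.take k ++ Word.reverse (w.drop k)) =
      wordHolonomyZd U x (w.take k) * (wordHolonomyZd U x (w.drop k))⁻¹ := by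
    rw [wordHolonomyZd_append, hk, ← wordHolonomyZd_reverse U x (w.drop k), hdrop]
  rw [e1, e2]
  exact trace_mul_trace_su_two _ _

/-- The re-oriented plaquette words are closed on `ℤ^d`. [folklore] -/
theorem Word.endpointZd_plaqWord (x : Site d) (a ν : Fin d) (ε : Bool) :
    Word.endpointZd x (plaqWord a ν ε) = x := by
  rw [← TiltedRP.endpoint_zdUnit, TiltedRP.endpoint_plaqWord]

/-- **`SU(2)` on `ℤ^d`: the plaquette term has no double-trace part**:
`plaqTerm = tr U_{w·P̃} − tr U_{w·P̃⁻¹}`. [folklore] -/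
theorem plaqTerm_su_two_zd (s : ℂ) (x : Site d) (a : Fin d) (U : LGConfig d (SU 2)) (w : Word d) (ν : Fin d)
    (ε : Bool) :
    TiltedRP.plaqTerm (fundamentalRep (Fin 2)) (TiltedRP.zdUnit d) s x a U w ν ε =
      (fundamentalRep (Fin 2) (wordHolonomyZd U x (w ++ plaqWord a ν ε))).trace -
        (fundamentalRep (Fin 2) (wordHolonomyZd U x (w ++ (plaqWord a ν ε).reverse))).trace := by
  unfold TiltedRP.plaqTerm
  simp only [TiltedRP.wordHolonomy_zdUnit]
  have h := wordHolonomyZd_reverse U x (plaqWord a ν ε)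
  rw [Word.endpointZd_plaqWord] at h
  rw [h, trace_fundamentalRep_two_inv, sub_self, mul_zero, mul_zero, sub_zero]

end Pointwise

/-! ### Integrated -/

section Integrated

variable (μ : Measure (LGConfig d (SU 2)))

/-- `SU(2)` on `ℤ^d`: the complex expectation of `tr U_w` is `2·E_w`, `E_w = ∫ W_x(w) dμ`. [folklore] -/
theorem integral_trace_su_two_zd (x : Site d) (w : Word d) :
    ∫ U, (fundamentalRep (Fin 2) (wordHolonomyZd U x w)).trace ∂μ =
      (((2 : ℝ) * ∫ U, wordLoopZd (suRep 2) x w U ∂μ : ℝ) : ℂ) := by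
  simp only [wordLoopZd_apply]
  rw [integral_const_mul, ← mul_assoc, show (2 : ℝ) * ((2 : ℕ) : ℝ)⁻¹ = 1 by norm_num, one_mul,
    ← integral_complex_ofReal]
  exact integral_congr_ae (ae_of_all _ fun U => trace_su_two_eq_ofReal _)

variable [IsFiniteMeasure μ]

/-- Integrability of `U ↦ tr U_v` on `ℤ^d` for a finite measure (`SU(2)`). [folklore] -/
theorem integrable_trace_su_two_zd (x : Site d) (v : Word d) :
    Integrable (fun U : LGConfig d (SU 2) => (fundamentalRep (Fin 2) (wordHolonomyZd U x v)).trace) μ :=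
  TiltedRP.integrable_of_continuous_zd (fundamentalLatticeRep 2) μ
    ((continuous_fundamentalRep (Fin 2)).comp (continuous_wordHolonomyZd x v)).matrix_trace

/-- **The split term integrates to single loop variables** (`SU(2)`, `ℤ^d`, periodic notation on the
left): for `w` closed at `x` with `w[0,k)` closed at `x`,
`∫ (tr U_{w[0,k)} tr U_{w[k,n)} − ½ tr U_w) dμ = E_w + 2·E_{w[0,k)·(w[k,n))⁻¹}`. [folklore] -/
theorem integral_split_su_two_zd (x : Site d) (w : Word d) (k : ℕ)
    (hw : TiltedRP.Word.endpoint (TiltedRP.zdUnit d) x w = x)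
    (hk : TiltedRP.Word.siteAt (TiltedRP.zdUnit d) x w k = x) :
    ∫ U, ((fundamentalRep (Fin 2) (TiltedRP.wordHolonomy (TiltedRP.zdUnit d) U x (w.take k))).trace *
          (fundamentalRep (Fin 2) (TiltedRP.wordHolonomy (TiltedRP.zdUnit d) U
            (TiltedRP.Word.siteAt (TiltedRP.zdUnit d) x w k) (w.drop k))).trace -
        (1 / (2 : ℕ)) * (fundamentalRep (Fin 2) (TiltedRP.wordHolonomy (TiltedRP.zdUnit d) U x w)).trace) ∂μ =
      ((∫ U, wordLoopZd (suRep 2) x w U ∂μ +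
          2 * ∫ U, wordLoopZd (suRep 2) x (w.take k ++ Word.reverse (w.drop k)) U ∂μ : ℝ) : ℂ) := by
  rw [TiltedRP.endpoint_zdUnit] at hw
  have hk' : Word.endpointZd x (w.take k) = x := by
    rw [← TiltedRP.endpoint_zdUnit]; exact hk
  rw [hk]
  simp only [TiltedRP.wordHolonomy_zdUnit]
  simp_rw [trace_split_su_two_zd x w k hw hk']
  have hfun : (fun U : LGConfig d (SU 2) =>
      (fundamentalRep (Fin 2) (wordHolonomyZd U x w)).trace +
          (fundamentalRep (Fin 2) (wordHolonomyZd U x (w.take k ++ Word.reverse (w.drop k)))).trace -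
        (1 / (2 : ℕ)) * (fundamentalRep (Fin 2) (wordHolonomyZd U x w)).trace) =
      fun U => (1 / (2 : ℕ) : ℂ) * (fundamentalRep (Fin 2) (wordHolonomyZd U x w)).trace +
        (fundamentalRep (Fin 2) (wordHolonomyZd U x (w.take k ++ Word.reverse (w.drop k)))).trace := by
    funext U; ring
  rw [hfun, integral_add ((integrable_trace_su_two_zd μ x _).const_mul _) (integrable_trace_su_two_zd μ x _),
    integral_const_mul, integral_trace_su_two_zd, integral_trace_su_two_zd]
  push_cast
  ring

/-- **The plaquette term integrates to single loop variables** (`SU(2)`, `ℤ^d`):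
`∫ plaqTerm_{ν,ε}(w) dμ = 2·(E_{w·P̃(ν,ε)} − E_{w·P̃(ν,ε)⁻¹})`. [folklore] -/
theorem integral_plaqTerm_su_two_zd (s : ℂ) (x : Site d) (a : Fin d) (w : Word d) (ν : Fin d) (ε : Bool) :
    ∫ U, TiltedRP.plaqTerm (fundamentalRep (Fin 2)) (TiltedRP.zdUnit d) s x a U w ν ε ∂μ =
      (((2 : ℝ) * (∫ U, wordLoopZd (suRep 2) x (w ++ plaqWord a ν ε) U ∂μ -
        ∫ U, wordLoopZd (suRep 2) x (w ++ (plaqWord a ν ε).reverse) U ∂μ) : ℝ) : ℂ) := by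
  simp_rw [plaqTerm_su_two_zd]
  rw [integral_sub (integrable_trace_su_two_zd μ x _) (integrable_trace_su_two_zd μ x _),
    integral_trace_su_two_zd, integral_trace_su_two_zd]
  push_cast
  ring

/-- **THE `SU(2)` LOOP EQUATION OF A HAAR-SHIFT STATE ON `ℤ^d` IN SINGLE LOOPS.** For a finite measure
`μ` with `IsHaarShiftState (suRep 2) β μ`, a word `w` closed at `x` and the link `(x, a)`:
`Σ_{k ∈ fwdOccZ} (E_w + 2·E_{w[0,k)·(w[k,n))⁻¹}) − Σ_{k ∈ bwdOccZ} (E_w + 2·E_{w[0,k]·(w(k,n))⁻¹})`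
`+ β·Σ_{ν ≠ a} Σ_ε (E_{w·P̃(a,ν,ε)} − E_{w·P̃(a,ν,ε)⁻¹}) = 0`, `E_v = ∫ W_x(v) dμ`. [folklore] -/
theorem IsHaarShiftState.loopEquation_su_two_loops {β : ℝ} (hμ : IsHaarShiftState (suRep 2) β μ)
    (x : Site d) (a : Fin d) (w : Word d) (hw : Word.endpointZd x w = x) :
    (∑ k ∈ (Finset.range w.length).filter (w.fwdOccZ a),
        (∫ U, wordLoopZd (suRep 2) x w U ∂μ +
          2 * ∫ U, wordLoopZd (suRep 2) x (w.take k ++ Word.reverse (w.drop k)) U ∂μ)) -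
      (∑ k ∈ (Finset.range w.length).filter (w.bwdOccZ a),
        (∫ U, wordLoopZd (suRep 2) x w U ∂μ +
          2 * ∫ U, wordLoopZd (suRep 2) x (w.take (k + 1) ++ Word.reverse (w.drop (k + 1))) U ∂μ)) +
      β * ∑ ν ∈ Finset.univ.erase a, ∑ ε : Bool,
        (∫ U, wordLoopZd (suRep 2) x (w ++ plaqWord a ν ε) U ∂μ -
          ∫ U, wordLoopZd (suRep 2) x (w ++ (plaqWord a ν ε).reverse) U ∂μ) = 0 := by
  have hw' : TiltedRP.Word.endpoint (TiltedRP.zdUnit d) x w = x := by rwa [TiltedRP.endpoint_zdUnit]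
  have h := hμ.loopEquationZd_schema_suN x a w hw'
  have hsm := TiltedRP.smallFor_zdUnit w
  -- forward occurrences: the prefix `w[0,k)` is closed at `x`
  have hf : ∀ k ∈ (Finset.range w.length).filter (w.fwdOccZ a),
      TiltedRP.Word.siteAt (TiltedRP.zdUnit d) x w k = x := fun k hk =>
    (TiltedRP.Word.siteAt_eq_iff_of_smallFor (TiltedRP.zdUnit d) hsm x k).2 (Finset.mem_filter.1 hk).2.2
  -- backward occurrences: the prefix `w[0,k]` is closed at `x`
  have hb : ∀ k ∈ (Finset.range w.length).filter (w.bwdOccZ a),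
      TiltedRP.Word.siteAt (TiltedRP.zdUnit d) x w (k + 1) = x := fun k hk => by
    obtain ⟨hk1, hk2⟩ := (Finset.mem_filter.1 hk).2
    refine (TiltedRP.Word.siteAt_eq_iff_of_smallFor (TiltedRP.zdUnit d) hsm x (k + 1)).2 ?_
    rw [Word.dispZ_succ_of_getElem? hk1, hk2]
    ext i
    by_cases hi : i = a
    · subst hi; simp [Step.dispZ]
    · simp [Step.dispZ, hi]
  rw [Finset.sum_congr rfl fun k hk => integral_split_su_two_zd μ x w k hw' (hf k hk),
    Finset.sum_congr rfl fun k hk => integral_split_su_two_zd μ x w (k + 1) hw' (hb k hk)] at h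
  simp only [integral_plaqTerm_su_two_zd] at h
  apply Complex.ofReal_injective
  push_cast at h ⊢
  simp only [← Finset.mul_sum] at h
  linear_combination h

/-- **The `SU(2)` single-loop loop equation holds for every Class-B state** (every real `β`). [folklore] -/
theorem ClassBState.loopEquation_su_two_loops {β : ℝ} (ω : ClassBState d (suRep 2) β) (x : Site d) (a : Fin d)
    (w : Word d) (hw : Word.endpointZd x w = x) :
    (∑ k ∈ (Finset.range w.length).filter (w.fwdOccZ a),
        (∫ U, wordLoopZd (suRep 2) x w U ∂ω.μ +
          2 * ∫ U, wordLoopZd (suRep 2) x (w.take k ++ Word.reverse (w.drop k)) U ∂ω.μ)) -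
      (∑ k ∈ (Finset.range w.length).filter (w.bwdOccZ a),
        (∫ U, wordLoopZd (suRep 2) x w U ∂ω.μ +
          2 * ∫ U, wordLoopZd (suRep 2) x (w.take (k + 1) ++ Word.reverse (w.drop (k + 1))) U ∂ω.μ)) +
      β * ∑ ν ∈ Finset.univ.erase a, ∑ ε : Bool,
        (∫ U, wordLoopZd (suRep 2) x (w ++ plaqWord a ν ε) U ∂ω.μ -
          ∫ U, wordLoopZd (suRep 2) x (w ++ (plaqWord a ν ε).reverse) U ∂ω.μ) = 0 := by
  haveI := ω.isProbabilityMeasure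
  exact ω.haarShift.loopEquation_su_two_loops ω.μ x a w hw

end Integrated

end Summit.QuantumFields.GaugeBoot

end
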